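import Summits.HodgeConjecture.HodgeConjecture.Theorems.WeilTypeLadderOnPath
import Literature.AlgebraicGeometry.HodgeTheory.WeilClassesCyclicPrym
import Literature.AlgebraicGeometry.HodgeTheory.WeilClassesCyclicPrymTyping
import Literature.AlgebraicGeometry.HodgeTheory.WeilClassesCyclicPrymDegreeThree
import HarnessLib

/-!
# WeilTypeLadder · the rung R2₈ (`SplitEightfolds`) on Schoen's cyclic Prym loci (K = ℚ(√-3))

b2b cell `hweil` (packet `run/shared/lean/b2b/hodge-weil/`, CENSUS.md ## P3-g2). The ladder rung
`WeilTypeLadder.SplitEightfolds` (R2₈: Weil classes on abelian EIGHTFOLDS of split Weil type, every `d`)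
is OPEN for the general member of every component ("What about Weil classes on abelian varieties of
dimension `≥ 8`?", Markman, arXiv:2509.23403 §12). It is NOT open on two classical positive-dimensional
loci, both already typed in the tree as REFEREED named facts (C. Schoen, Compositio Math. 65 (1988),
Cor. 3.1 with Thm. 2.0, case `r = 0` — no genericity hypothesis on the cover; = Patel–Zhang 2025 Thm. 5.3):

* `Schoen1988_cyclicPrym_weilClasses_algebraic_degreeThree` — the Prym EIGHTFOLD
  `P = (ker(𝟙 + α_* + α_*²))⁰ ⊂ J(C)` of an étale cyclic TRIPLE cover `C → C'` of a genus-`5` curve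
  (`g(C) = 13`), `ψ₀ = 𝟙 + 2α_*|_P`, `ψ₀² = -3`: every class of `weilClassesOf P ψ₀ 4 3` is algebraic;
* `Schoen1988_cyclicPrym_weilClasses_algebraic_degreeSix` — Schoen's primitive Prym EIGHTFOLD
  `B = (ker(𝟙 - α_* + α_*²))⁰ ⊂ J(C)` of an étale cyclic cover of degree `6` of a genus-`5` curve
  (`g(C) = 25`), `ψ₀ = 𝟙 + 2(α_*|_B)²`, `ψ₀² = -3`: every class of the typed plane
  `Eig((2·𝟙+ψ₀)^*,(2+i√3)⁸) ⊔ Eig((2·𝟙+ψ₀)^*,(2-i√3)⁸)` — which IS `weilClassesOf B ψ₀ 4 3`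
  (`eigenspace_sup_eigenspace_eq_weilClassesOf`, a tree theorem) — is algebraic.

This file proves, for each locus: (i) the literal body of R2₈ at `d = 3` with `(A, φ) := (P, ψ₀)`
resp. `(B, ψ₀)` FOLLOWS from the refereed fact (a CASE of R2₈ proved modulo [Schoen 1988, Cor. 3.1];
the rung's hypotheses `dim = 8`, smooth projective, hyperbolic polarization, rational, Hodge type
are carried and not used — the fact gives every class of the Weil plane); (ii) the same body follows
from the rung R2₈ itself and (iii) from `HodgeConjecture` (on-path, via
`splitEightfolds_of_hodgeConjecture`); (iv) the R∞-shaped body (`WeilClassesImaginaryQuadratic` at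
`n = 4`, `d = 3`) on the same loci.

HONEST LABEL. These loci are 12-dimensional (moduli of `(C', η)`, `g(C') = 5`, `η ∈ J(C')[3]` resp.
a cyclic subgroup of order `6`) inside the 16-dimensional moduli of `(4,4)` ℚ(√-3)-Weil eightfolds; the
abelian varieties are of SPLIT type (`det H ≡ (-1)⁴`: packet `b2b-hweil-pv3-g2/DISCRIMINANT-CORRECTION.md`,
two independent exact computations of van Geemen's `det H` for cyclic Pryms — a packet-level statement,
nothing about hyperbolicity is asserted or used in Lean). Known since 1988; typed here so that the
ladder's census of R2₈ is exact: OPEN for the general member, PROVED (mod a refereed fact) on the cyclic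
Prym loci. 0 unconditional rungs are added. No `sorry`, no new definitions, no new facts.
-/

noncomputable section

-- every declaration of this problem lives in `Summit.HodgeConjecture.HodgeConjecture.…` (summit = sub-problem)
set_option linter.dupNamespace false

open CategoryTheory
open Literature.AlgebraicGeometry Literature.AlgebraicGeometry.Motives
open Literature.AlgebraicGeometry.HodgeTheory
open Literature.AlgebraicTopology.SingularHomology

namespace Summit.HodgeConjecture.HodgeConjecture.WeilTypeLadder

/-! ### The triple-cover locus: `P = (ker Φ₃(α_*))⁰ ⊂ J(C₁₃)`, `ψ₀ = 𝟙 + 2 s_P` -/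

section DegreeThree

/-- **R2₈ on Schoen's Prym eightfolds of étale cyclic triple covers of genus-`5` curves, from the
refereed fact.** For every Schoen datum `(C, 𝒥, α, s = α_*, P = (ker(𝟙 + s + s²))⁰, s_P, ψ₀ = 𝟙 + 2 s_P)`
of `Schoen1988_cyclicPrym_weilClasses_algebraic_degreeThree`, the literal body of `SplitEightfolds` at
`d = 3`, `(A, φ) := (P, ψ₀)` holds: for every projective embedding `e`, every rational `a ≠ 0` with
hyperbolic `K`-symmetrised hyperplane class, every rational `(4,4)`-class of `weilClassesOf P ψ₀ 4 3` is
algebraic — because the fact gives this for EVERY class of the Weil plane. Conditional on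
[Schoen 1988, Cor. 3.1 with Thm. 2.0 at `(q,m,r) = (5,3,0)`] (refereed) only.
[cite: Schoen1988HodgeWeil, Thm 2.0 (p. 11) and Cor 3.1 (p. 24)] [cite: PatelZhang2025PrymHodge, Thm 5.3] -/
theorem splitEightfolds_cyclicPrymThree_of_schoen
    (hS : Schoen1988_cyclicPrym_weilClasses_algebraic_degreeThree) :
    ∀ (C : SchemeOver ℂ) (𝒥 : Jacobian C) (α : C ⟶ C),
      IsSmoothProjective 1 C → 𝒥.J.dim = 13 →
      α ≫ α ≫ α = 𝟙 C →
      (∀ P : ComplexPoints C, P ≫ α ≠ P) →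
    ∀ (s : 𝒥.J ⟶ 𝒥.J), s = 𝒥.pushforward 𝒥 α →
    ∀ (sP ψ₀ : AbelianVariety.kerComponent (𝟙 𝒥.J + s + s ≫ s) ⟶
        AbelianVariety.kerComponent (𝟙 𝒥.J + s + s ≫ s)),
      sP ≫ AbelianVariety.kerComponentι (𝟙 𝒥.J + s + s ≫ s) =
        AbelianVariety.kerComponentι (𝟙 𝒥.J + s + s ≫ s) ≫ s →
      ψ₀ = 𝟙 _ + 2 • sP →
      (AbelianVariety.kerComponent (𝟙 𝒥.J + s + s ≫ s)).dim = 2 * 4 →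
      IsSmoothProjective (2 * 4) (AbelianVariety.kerComponent (𝟙 𝒥.J + s + s ≫ s)).X →
      ψ₀ ≫ ψ₀ = -((3 : ℕ) • 𝟙 _) →
      ∀ (e : ProjectiveEmbedding (AbelianVariety.kerComponent (𝟙 𝒥.J + s + s ≫ s)).X)
        (a : complexBetti (projectiveSpace e.n ℂ) 2), IsRationalClass a → a ≠ 0 →
        IsHyperbolicWeilType (AbelianVariety.kerComponent (𝟙 𝒥.J + s + s ≫ s)) ψ₀ 4
          ((((3 : ℕ) : ℂ)) • complexBetti.map e.ι 2 a +
            complexBetti.map ψ₀.hom.hom.hom 2 (complexBetti.map e.ι 2 a)) →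
        ∀ c : complexBetti (AbelianVariety.kerComponent (𝟙 𝒥.J + s + s ≫ s)).X (2 * 4),
          IsRationalClass c →
          IsOfHodgeType (2 * 4) (AbelianVariety.kerComponent (𝟙 𝒥.J + s + s ≫ s)).X (2 * 4) 4 4 c →
          c ∈ weilClassesOf (AbelianVariety.kerComponent (𝟙 𝒥.J + s + s ≫ s)) ψ₀ 4 3 →
          c ∈ algebraicClasses (AbelianVariety.kerComponent (𝟙 𝒥.J + s + s ≫ s)).X 4 := by
  intro C 𝒥 α hC h13 hα hfree s hs sP ψ₀ hsP hψ₀ _ _ _ e a _ _ _ c _ _ hW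
  exact hS C 𝒥 α hC h13 hα hfree s hs sP ψ₀ hsP hψ₀ c hW

/-- **The same body from the rung R2₈ itself** (`SplitEightfolds` at `d = 3`, specialised to
`(A, φ) := (P, ψ₀)`): the cyclic-Prym locus is a CASE of the rung. -/
theorem splitEightfolds_cyclicPrymThree_of_splitEightfolds (h : SplitEightfolds) :
    ∀ (C : SchemeOver ℂ) (𝒥 : Jacobian C) (α : C ⟶ C),
      IsSmoothProjective 1 C → 𝒥.J.dim = 13 →
      α ≫ α ≫ α = 𝟙 C →
      (∀ P : ComplexPoints C, P ≫ α ≠ P) →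
    ∀ (s : 𝒥.J ⟶ 𝒥.J), s = 𝒥.pushforward 𝒥 α →
    ∀ (sP ψ₀ : AbelianVariety.kerComponent (𝟙 𝒥.J + s + s ≫ s) ⟶
        AbelianVariety.kerComponent (𝟙 𝒥.J + s + s ≫ s)),
      sP ≫ AbelianVariety.kerComponentι (𝟙 𝒥.J + s + s ≫ s) =
        AbelianVariety.kerComponentι (𝟙 𝒥.J + s + s ≫ s) ≫ s →
      ψ₀ = 𝟙 _ + 2 • sP →
      (AbelianVariety.kerComponent (𝟙 𝒥.J + s + s ≫ s)).dim = 2 * 4 →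
      IsSmoothProjective (2 * 4) (AbelianVariety.kerComponent (𝟙 𝒥.J + s + s ≫ s)).X →
      ψ₀ ≫ ψ₀ = -((3 : ℕ) • 𝟙 _) →
      ∀ (e : ProjectiveEmbedding (AbelianVariety.kerComponent (𝟙 𝒥.J + s + s ≫ s)).X)
        (a : complexBetti (projectiveSpace e.n ℂ) 2), IsRationalClass a → a ≠ 0 →
        IsHyperbolicWeilType (AbelianVariety.kerComponent (𝟙 𝒥.J + s + s ≫ s)) ψ₀ 4
          ((((3 : ℕ) : ℂ)) • complexBetti.map e.ι 2 a +
            complexBetti.map ψ₀.hom.hom.hom 2 (complexBetti.map e.ι 2 a)) →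
        ∀ c : complexBetti (AbelianVariety.kerComponent (𝟙 𝒥.J + s + s ≫ s)).X (2 * 4),
          IsRationalClass c →
          IsOfHodgeType (2 * 4) (AbelianVariety.kerComponent (𝟙 𝒥.J + s + s ≫ s)).X (2 * 4) 4 4 c →
          c ∈ weilClassesOf (AbelianVariety.kerComponent (𝟙 𝒥.J + s + s ≫ s)) ψ₀ 4 3 →
          c ∈ algebraicClasses (AbelianVariety.kerComponent (𝟙 𝒥.J + s + s ≫ s)).X 4 := by
  intro C 𝒥 α _ _ _ _ s _ sP ψ₀ _ _ hdim hX hψ e a ha ha0 hh c hc h44 hW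
  exact h 3 (by norm_num) _ ψ₀ hdim hX hψ e a ha ha0 hh c hc h44 hW

/-- **On-path lemma**: the Hodge conjecture implies R2₈ on the cyclic triple-cover Prym locus
(`HodgeConjecture → SplitEightfolds →` the locus). -/
theorem splitEightfolds_cyclicPrymThree_of_hodgeConjecture (h : _root_.HodgeConjecture) :
    ∀ (C : SchemeOver ℂ) (𝒥 : Jacobian C) (α : C ⟶ C),
      IsSmoothProjective 1 C → 𝒥.J.dim = 13 →
      α ≫ α ≫ α = 𝟙 C →
      (∀ P : ComplexPoints C, P ≫ α ≠ P) →
    ∀ (s : 𝒥.J ⟶ 𝒥.J), s = 𝒥.pushforward 𝒥 α →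
    ∀ (sP ψ₀ : AbelianVariety.kerComponent (𝟙 𝒥.J + s + s ≫ s) ⟶
        AbelianVariety.kerComponent (𝟙 𝒥.J + s + s ≫ s)),
      sP ≫ AbelianVariety.kerComponentι (𝟙 𝒥.J + s + s ≫ s) =
        AbelianVariety.kerComponentι (𝟙 𝒥.J + s + s ≫ s) ≫ s →
      ψ₀ = 𝟙 _ + 2 • sP →
      (AbelianVariety.kerComponent (𝟙 𝒥.J + s + s ≫ s)).dim = 2 * 4 →
      IsSmoothProjective (2 * 4) (AbelianVariety.kerComponent (𝟙 𝒥.J + s + s ≫ s)).X →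
      ψ₀ ≫ ψ₀ = -((3 : ℕ) • 𝟙 _) →
      ∀ (e : ProjectiveEmbedding (AbelianVariety.kerComponent (𝟙 𝒥.J + s + s ≫ s)).X)
        (a : complexBetti (projectiveSpace e.n ℂ) 2), IsRationalClass a → a ≠ 0 →
        IsHyperbolicWeilType (AbelianVariety.kerComponent (𝟙 𝒥.J + s + s ≫ s)) ψ₀ 4
          ((((3 : ℕ) : ℂ)) • complexBetti.map e.ι 2 a +
            complexBetti.map ψ₀.hom.hom.hom 2 (complexBetti.map e.ι 2 a)) →
        ∀ c : complexBetti (AbelianVariety.kerComponent (𝟙 𝒥.J + s + s ≫ s)).X (2 * 4),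
          IsRationalClass c →
          IsOfHodgeType (2 * 4) (AbelianVariety.kerComponent (𝟙 𝒥.J + s + s ≫ s)).X (2 * 4) 4 4 c →
          c ∈ weilClassesOf (AbelianVariety.kerComponent (𝟙 𝒥.J + s + s ≫ s)) ψ₀ 4 3 →
          c ∈ algebraicClasses (AbelianVariety.kerComponent (𝟙 𝒥.J + s + s ≫ s)).X 4 :=
  splitEightfolds_cyclicPrymThree_of_splitEightfolds (splitEightfolds_of_hodgeConjecture h)

/-- **R∞-shaped instance** (`WeilClassesImaginaryQuadratic` at `n = 4`, `d = 3`, `(A, φ) := (P, ψ₀)`;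
no polarization hypothesis at all) on the cyclic triple-cover Prym locus, from the refereed fact.
[cite: Schoen1988HodgeWeil, Thm 2.0 (p. 11) and Cor 3.1 (p. 24)] -/
theorem weilClassesImaginaryQuadratic_cyclicPrymThree_of_schoen
    (hS : Schoen1988_cyclicPrym_weilClasses_algebraic_degreeThree) :
    ∀ (C : SchemeOver ℂ) (𝒥 : Jacobian C) (α : C ⟶ C),
      IsSmoothProjective 1 C → 𝒥.J.dim = 13 →
      α ≫ α ≫ α = 𝟙 C →
      (∀ P : ComplexPoints C, P ≫ α ≠ P) →
    ∀ (s : 𝒥.J ⟶ 𝒥.J), s = 𝒥.pushforward 𝒥 α →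
    ∀ (sP ψ₀ : AbelianVariety.kerComponent (𝟙 𝒥.J + s + s ≫ s) ⟶
        AbelianVariety.kerComponent (𝟙 𝒥.J + s + s ≫ s)),
      sP ≫ AbelianVariety.kerComponentι (𝟙 𝒥.J + s + s ≫ s) =
        AbelianVariety.kerComponentι (𝟙 𝒥.J + s + s ≫ s) ≫ s →
      ψ₀ = 𝟙 _ + 2 • sP →
      (AbelianVariety.kerComponent (𝟙 𝒥.J + s + s ≫ s)).dim = 2 * 4 →
      IsSmoothProjective (2 * 4) (AbelianVariety.kerComponent (𝟙 𝒥.J + s + s ≫ s)).X →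
      ψ₀ ≫ ψ₀ = -((3 : ℕ) • 𝟙 _) →
      ∀ c : complexBetti (AbelianVariety.kerComponent (𝟙 𝒥.J + s + s ≫ s)).X (2 * 4),
        IsRationalClass c →
        IsOfHodgeType (2 * 4) (AbelianVariety.kerComponent (𝟙 𝒥.J + s + s ≫ s)).X (2 * 4) 4 4 c →
        c ∈ weilClassesOf (AbelianVariety.kerComponent (𝟙 𝒥.J + s + s ≫ s)) ψ₀ 4 3 →
        c ∈ algebraicClasses (AbelianVariety.kerComponent (𝟙 𝒥.J + s + s ≫ s)).X 4 := by
  intro C 𝒥 α hC h13 hα hfree s hs sP ψ₀ hsP hψ₀ _ _ _ c _ _ hW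
  exact hS C 𝒥 α hC h13 hα hfree s hs sP ψ₀ hsP hψ₀ c hW

end DegreeThree

/-! ### The degree-`6` locus: `B = (ker Φ₆(α_*))⁰ ⊂ J(C₂₅)`, `ψ₀ = 𝟙 + 2 s_B²` -/

section DegreeSix

/-- **Schoen's degree-`6` fact in the `weilClassesOf` vocabulary**: on Schoen's primitive Prym
eightfold `B = (ker(𝟙 - s + s²))⁰` (`s = α_*`, `α` of order `6` acting freely through `α²`, `α³`,
`g(C) = 25`) with `ψ₀ = 𝟙 + 2 s_B²`, EVERY class of `weilClassesOf B ψ₀ 4 3` is algebraic. The fact is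
stated on the typed plane `Eig((2·𝟙+ψ₀)^*,(2±i√3)⁸)`; that plane equals the Weil plane by the tree
theorem `eigenspace_sup_eigenspace_eq_weilClassesOf` (for `ψ₀² = -3`, `H• = ⋀•H¹`).
[cite: Schoen1988HodgeWeil, Thm 2.0 (p. 11) and Cor 3.1 (p. 24)] [cite: PatelZhang2025PrymHodge, Thm 5.3] -/
theorem weilClassesOf_le_algebraicClasses_cyclicPrymSix_of_schoen
    (hS : Schoen1988_cyclicPrym_weilClasses_algebraic_degreeSix) :
    ∀ (C : SchemeOver ℂ) (𝒥 : Jacobian C) (α : C ⟶ C),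
      IsSmoothProjective 1 C → 𝒥.J.dim = 25 →
      α ≫ α ≫ α ≫ α ≫ α ≫ α = 𝟙 C →
      (∀ P : ComplexPoints C, P ≫ (α ≫ α) ≠ P ∧ P ≫ (α ≫ α ≫ α) ≠ P) →
    ∀ (s : 𝒥.J ⟶ 𝒥.J), s = 𝒥.pushforward 𝒥 α →
    ∀ (sB ψ₀ : AbelianVariety.kerComponent (𝟙 𝒥.J - s + s ≫ s) ⟶
        AbelianVariety.kerComponent (𝟙 𝒥.J - s + s ≫ s)),
      sB ≫ AbelianVariety.kerComponentι (𝟙 𝒥.J - s + s ≫ s) =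
        AbelianVariety.kerComponentι (𝟙 𝒥.J - s + s ≫ s) ≫ s →
      ψ₀ = 𝟙 _ + 2 • (sB ≫ sB) →
      weilClassesOf (AbelianVariety.kerComponent (𝟙 𝒥.J - s + s ≫ s)) ψ₀ 4 3 ≤
        algebraicClasses (AbelianVariety.kerComponent (𝟙 𝒥.J - s + s ≫ s)).X 4 := by
  intro C 𝒥 α hC h25 hα hfree s hs sB ψ₀ hsB hψ₀ c hc
  have hΛ := Motives.abelianVarietyCohomologyExteriorH1_holds.hasExteriorCohomologyH1
    (AbelianVariety.kerComponent (𝟙 𝒥.J - s + s ≫ s))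
  have hψ : ψ₀ ≫ ψ₀ = -(3 • 𝟙 _) := kerComponent_weilOperator_comp_self' hsB hψ₀
  rw [← eigenspace_sup_eigenspace_eq_weilClassesOf hΛ hψ] at hc
  exact hS C 𝒥 α hC h25 hα hfree s hs sB ψ₀ hsB hψ₀ c hc

/-- **R2₈ on Schoen's primitive Prym eightfolds of étale cyclic degree-`6` covers of genus-`5`
curves, from the refereed fact**: the literal body of `SplitEightfolds` at `d = 3`,
`(A, φ) := (B, ψ₀)`. Conditional on [Schoen 1988, Cor. 3.1 with Thm. 2.0 at `(q,m,r) = (5,6,0)`]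
(refereed) only. [cite: Schoen1988HodgeWeil, Thm 2.0 (p. 11) and Cor 3.1 (p. 24)] -/
theorem splitEightfolds_cyclicPrymSix_of_schoen
    (hS : Schoen1988_cyclicPrym_weilClasses_algebraic_degreeSix) :
    ∀ (C : SchemeOver ℂ) (𝒥 : Jacobian C) (α : C ⟶ C),
      IsSmoothProjective 1 C → 𝒥.J.dim = 25 →
      α ≫ α ≫ α ≫ α ≫ α ≫ α = 𝟙 C →
      (∀ P : ComplexPoints C, P ≫ (α ≫ α) ≠ P ∧ P ≫ (α ≫ α ≫ α) ≠ P) →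
    ∀ (s : 𝒥.J ⟶ 𝒥.J), s = 𝒥.pushforward 𝒥 α →
    ∀ (sB ψ₀ : AbelianVariety.kerComponent (𝟙 𝒥.J - s + s ≫ s) ⟶
        AbelianVariety.kerComponent (𝟙 𝒥.J - s + s ≫ s)),
      sB ≫ AbelianVariety.kerComponentι (𝟙 𝒥.J - s + s ≫ s) =
        AbelianVariety.kerComponentι (𝟙 𝒥.J - s + s ≫ s) ≫ s →
      ψ₀ = 𝟙 _ + 2 • (sB ≫ sB) →
      (AbelianVariety.kerComponent (𝟙 𝒥.J - s + s ≫ s)).dim = 2 * 4 →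
      IsSmoothProjective (2 * 4) (AbelianVariety.kerComponent (𝟙 𝒥.J - s + s ≫ s)).X →
      ψ₀ ≫ ψ₀ = -((3 : ℕ) • 𝟙 _) →
      ∀ (e : ProjectiveEmbedding (AbelianVariety.kerComponent (𝟙 𝒥.J - s + s ≫ s)).X)
        (a : complexBetti (projectiveSpace e.n ℂ) 2), IsRationalClass a → a ≠ 0 →
        IsHyperbolicWeilType (AbelianVariety.kerComponent (𝟙 𝒥.J - s + s ≫ s)) ψ₀ 4
          ((((3 : ℕ) : ℂ)) • complexBetti.map e.ι 2 a +
            complexBetti.map ψ₀.hom.hom.hom 2 (complexBetti.map e.ι 2 a)) →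
        ∀ c : complexBetti (AbelianVariety.kerComponent (𝟙 𝒥.J - s + s ≫ s)).X (2 * 4),
          IsRationalClass c →
          IsOfHodgeType (2 * 4) (AbelianVariety.kerComponent (𝟙 𝒥.J - s + s ≫ s)).X (2 * 4) 4 4 c →
          c ∈ weilClassesOf (AbelianVariety.kerComponent (𝟙 𝒥.J - s + s ≫ s)) ψ₀ 4 3 →
          c ∈ algebraicClasses (AbelianVariety.kerComponent (𝟙 𝒥.J - s + s ≫ s)).X 4 := by
  intro C 𝒥 α hC h25 hα hfree s hs sB ψ₀ hsB hψ₀ _ _ _ e a _ _ _ c _ _ hW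
  exact weilClassesOf_le_algebraicClasses_cyclicPrymSix_of_schoen hS C 𝒥 α hC h25 hα hfree s hs sB ψ₀
    hsB hψ₀ hW

/-- **The same body from the rung R2₈ itself** (the degree-`6` cyclic-Prym locus is a CASE of
`SplitEightfolds` at `d = 3`). -/
theorem splitEightfolds_cyclicPrymSix_of_splitEightfolds (h : SplitEightfolds) :
    ∀ (C : SchemeOver ℂ) (𝒥 : Jacobian C) (α : C ⟶ C),
      IsSmoothProjective 1 C → 𝒥.J.dim = 25 →
      α ≫ α ≫ α ≫ α ≫ α ≫ α = 𝟙 C →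
      (∀ P : ComplexPoints C, P ≫ (α ≫ α) ≠ P ∧ P ≫ (α ≫ α ≫ α) ≠ P) →
    ∀ (s : 𝒥.J ⟶ 𝒥.J), s = 𝒥.pushforward 𝒥 α →
    ∀ (sB ψ₀ : AbelianVariety.kerComponent (𝟙 𝒥.J - s + s ≫ s) ⟶
        AbelianVariety.kerComponent (𝟙 𝒥.J - s + s ≫ s)),
      sB ≫ AbelianVariety.kerComponentι (𝟙 𝒥.J - s + s ≫ s) =
        AbelianVariety.kerComponentι (𝟙 𝒥.J - s + s ≫ s) ≫ s →
      ψ₀ = 𝟙 _ + 2 • (sB ≫ sB) →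
      (AbelianVariety.kerComponent (𝟙 𝒥.J - s + s ≫ s)).dim = 2 * 4 →
      IsSmoothProjective (2 * 4) (AbelianVariety.kerComponent (𝟙 𝒥.J - s + s ≫ s)).X →
      ψ₀ ≫ ψ₀ = -((3 : ℕ) • 𝟙 _) →
      ∀ (e : ProjectiveEmbedding (AbelianVariety.kerComponent (𝟙 𝒥.J - s + s ≫ s)).X)
        (a : complexBetti (projectiveSpace e.n ℂ) 2), IsRationalClass a → a ≠ 0 →
        IsHyperbolicWeilType (AbelianVariety.kerComponent (𝟙 𝒥.J - s + s ≫ s)) ψ₀ 4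
          ((((3 : ℕ) : ℂ)) • complexBetti.map e.ι 2 a +
            complexBetti.map ψ₀.hom.hom.hom 2 (complexBetti.map e.ι 2 a)) →
        ∀ c : complexBetti (AbelianVariety.kerComponent (𝟙 𝒥.J - s + s ≫ s)).X (2 * 4),
          IsRationalClass c →
          IsOfHodgeType (2 * 4) (AbelianVariety.kerComponent (𝟙 𝒥.J - s + s ≫ s)).X (2 * 4) 4 4 c →
          c ∈ weilClassesOf (AbelianVariety.kerComponent (𝟙 𝒥.J - s + s ≫ s)) ψ₀ 4 3 →
          c ∈ algebraicClasses (AbelianVariety.kerComponent (𝟙 𝒥.J - s + s ≫ s)).X 4 := by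
  intro C 𝒥 α _ _ _ _ s _ sB ψ₀ _ _ hdim hX hψ e a ha ha0 hh c hc h44 hW
  exact h 3 (by norm_num) _ ψ₀ hdim hX hψ e a ha ha0 hh c hc h44 hW

/-- **On-path lemma**: the Hodge conjecture implies R2₈ on the degree-`6` cyclic-Prym locus. -/
theorem splitEightfolds_cyclicPrymSix_of_hodgeConjecture (h : _root_.HodgeConjecture) :
    ∀ (C : SchemeOver ℂ) (𝒥 : Jacobian C) (α : C ⟶ C),
      IsSmoothProjective 1 C → 𝒥.J.dim = 25 →
      α ≫ α ≫ α ≫ α ≫ α ≫ α = 𝟙 C →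
      (∀ P : ComplexPoints C, P ≫ (α ≫ α) ≠ P ∧ P ≫ (α ≫ α ≫ α) ≠ P) →
    ∀ (s : 𝒥.J ⟶ 𝒥.J), s = 𝒥.pushforward 𝒥 α →
    ∀ (sB ψ₀ : AbelianVariety.kerComponent (𝟙 𝒥.J - s + s ≫ s) ⟶
        AbelianVariety.kerComponent (𝟙 𝒥.J - s + s ≫ s)),
      sB ≫ AbelianVariety.kerComponentι (𝟙 𝒥.J - s + s ≫ s) =
        AbelianVariety.kerComponentι (𝟙 𝒥.J - s + s ≫ s) ≫ s →
      ψ₀ = 𝟙 _ + 2 • (sB ≫ sB) →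
      (AbelianVariety.kerComponent (𝟙 𝒥.J - s + s ≫ s)).dim = 2 * 4 →
      IsSmoothProjective (2 * 4) (AbelianVariety.kerComponent (𝟙 𝒥.J - s + s ≫ s)).X →
      ψ₀ ≫ ψ₀ = -((3 : ℕ) • 𝟙 _) →
      ∀ (e : ProjectiveEmbedding (AbelianVariety.kerComponent (𝟙 𝒥.J - s + s ≫ s)).X)
        (a : complexBetti (projectiveSpace e.n ℂ) 2), IsRationalClass a → a ≠ 0 →
        IsHyperbolicWeilType (AbelianVariety.kerComponent (𝟙 𝒥.J - s + s ≫ s)) ψ₀ 4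
          ((((3 : ℕ) : ℂ)) • complexBetti.map e.ι 2 a +
            complexBetti.map ψ₀.hom.hom.hom 2 (complexBetti.map e.ι 2 a)) →
        ∀ c : complexBetti (AbelianVariety.kerComponent (𝟙 𝒥.J - s + s ≫ s)).X (2 * 4),
          IsRationalClass c →
          IsOfHodgeType (2 * 4) (AbelianVariety.kerComponent (𝟙 𝒥.J - s + s ≫ s)).X (2 * 4) 4 4 c →
          c ∈ weilClassesOf (AbelianVariety.kerComponent (𝟙 𝒥.J - s + s ≫ s)) ψ₀ 4 3 →
          c ∈ algebraicClasses (AbelianVariety.kerComponent (𝟙 𝒥.J - s + s ≫ s)).X 4 :=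
  splitEightfolds_cyclicPrymSix_of_splitEightfolds (splitEightfolds_of_hodgeConjecture h)

end DegreeSix

end Summit.HodgeConjecture.HodgeConjecture.WeilTypeLadder

end
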